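import Mathlib

/-!
# The κ-integrated R-law and gate of a CHAINED OR-vertex are log-supermodular
(blind cell PercRepro2, night-2 g16; proofs/NIGHT2-DARC.md §56)

Row 2′DARC at the free arc `a → w` where the OR-vertex `a` is entered from the core `U` (entries
`ent`, sure) AND from a second OR-vertex `a'` (entered from `ent' ⊆ U`, sure) by ONE random arc
`a' → a` of probability `ρ`.  Integrating the coin out, the `R`-law at a core level `W ⊆ U` is
`ν(W)·r_ρ(W)` with `r_ρ = c` when `W` meets neither entry set, `(1 − ρ)·c + ρ·d` when `W` meets
`ent'` but not `ent` (the vertex `a` is reached iff the coin is open), and `d` when `W` meets `ent`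
(`c = B(W + closure)`, `d = B(W + closure + a)`, `B` the log-supermodular decreasing head; the gate
has `d' = B(· + a + w)` in place of `d`).  The structural limit «chained OR-vertices = non-lsm
core» of §49.6 (b) is WRONG at the integrated level: `r_ρ` (and the gate) IS log-supermodular.

* `ratio_cross_le` — the 2×2 RATIO LEMMA for a log-supermodular function on the lattice
  `{S ∩ T, S, T, S ∪ T} × {without a, with a}` (values `A, B, C, D` without `a`, `A', B', C', D'`
  with `a`): `B·C' + B'·C ≤ A·D' + A'·D`.  Its proof is the ratio argument with the certificate
  `uv(u₀ + u₁) − u₀u₁(u + v) = u₁(u − u₀)(v − u₀) + u₀(uv − u₀u₁)`.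
* `mixture_lsm` — the three-region mixture `m = (1 − θ)·c + θ·d`, `θ ∈ {0, ρ, 1}` by the entry
  pattern, is log-supermodular whenever `c, d` are nonnegative, log-supermodular, jointly
  log-supermodular, `d ≤ c`, and the ratio `d / c` is increasing.

Mathlib only.  Exact census (work/chain, this seat): 0 / 185,536 pairs for the two laws,
0 / 34,704 pairs for the ratio lemma (12,018 failures on log-submodular controls).
-/

namespace Summit.Ventures.PercRepro2.Coin

section RatioLemma

variable {R : Type*} [Field R] [LinearOrder R] [IsStrictOrderedRing R]

/-- The ratio lemma in ratio form: `0 ≤ u₀ ≤ u, v ≤ u₁`, `0 < P ≤ Q`, `v·P ≤ u₁·Q`,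
`u·P ≤ u₁·Q`, `u·v·P ≤ u₀·u₁·Q` ⟹ `(u + v)·P ≤ (u₀ + u₁)·Q`. -/
lemma ratio_form (u₀ u v u₁ P Q : R) (hu₀ : 0 ≤ u₀) (h0u : u₀ ≤ u) (h0v : u₀ ≤ v) (hu1 : u ≤ u₁)
    (hv1 : v ≤ u₁) (hP : 0 < P) (hPQ : P ≤ Q) (hv : v * P ≤ u₁ * Q) (hu : u * P ≤ u₁ * Q)
    (huv : u * v * P ≤ u₀ * u₁ * Q) : (u + v) * P ≤ (u₀ + u₁) * Q := by
  have hQ : 0 < Q := lt_of_lt_of_le hP hPQ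
  have hu0 : 0 ≤ u := le_trans hu₀ h0u
  have hv0 : 0 ≤ v := le_trans hu₀ h0v
  have hu₁0 : 0 ≤ u₁ := le_trans hu0 hu1
  by_cases hcase : u₀ * u₁ ≤ u * v
  · -- case uv ≥ u₀u₁
    rcases eq_or_lt_of_le hu0 with hu_zero | hu_pos
    · -- u = 0
      subst hu_zero
      have : 0 ≤ u₀ * Q := mul_nonneg hu₀ hQ.le
      nlinarith
    rcases eq_or_lt_of_le hv0 with hv_zero | hv_pos
    · subst hv_zero
      have : 0 ≤ u₀ * Q := mul_nonneg hu₀ hQ.le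
      nlinarith
    -- key: u₀u₁(u+v) ≤ uv(u₀+u₁), certificate u₁(u−u₀)(v−u₀) + u₀(uv − u₀u₁) ≥ 0
    have key : u₀ * u₁ * (u + v) ≤ u * v * (u₀ + u₁) := by
      have h1 : 0 ≤ u₁ * ((u - u₀) * (v - u₀)) :=
        mul_nonneg hu₁0 (mul_nonneg (by linarith) (by linarith))
      have h2 : 0 ≤ u₀ * (u * v - u₀ * u₁) := mul_nonneg hu₀ (by linarith)
      nlinarith
    have huv_pos : 0 < u * v := mul_pos hu_pos hv_pos
    -- (u+v)·P·(uv) ≤ (u+v)·u₀u₁·Q ≤ uv(u₀+u₁)·Q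
    have step1 : (u + v) * P * (u * v) ≤ (u + v) * (u₀ * u₁ * Q) := by
      have : 0 ≤ u + v := by linarith
      calc (u + v) * P * (u * v) = (u + v) * (u * v * P) := by ring
        _ ≤ (u + v) * (u₀ * u₁ * Q) := mul_le_mul_of_nonneg_left huv this
    have step2 : (u + v) * (u₀ * u₁ * Q) ≤ (u₀ + u₁) * Q * (u * v) := by
      calc (u + v) * (u₀ * u₁ * Q) = (u₀ * u₁ * (u + v)) * Q := by ring
        _ ≤ (u * v * (u₀ + u₁)) * Q := mul_le_mul_of_nonneg_right key hQ.le
        _ = (u₀ + u₁) * Q * (u * v) := by ring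
    exact le_of_mul_le_mul_right (le_trans step1 step2) huv_pos
  · -- case uv < u₀u₁: u + v ≤ u₀ + u₁
    push Not at hcase
    have hsum : u + v ≤ u₀ + u₁ := by
      rcases eq_or_lt_of_le hu₁0 with h1z | h1p
      · have : u = 0 := le_antisymm (h1z ▸ hu1) hu0
        have : v = 0 := le_antisymm (h1z ▸ hv1) hv0
        subst_vars; linarith
      · have h3 : 0 ≤ (u₁ - u) * (u₁ - v) := mul_nonneg (by linarith) (by linarith)
        -- u₁(u+v) ≤ u₁² + uv < u₁² + u₀u₁
        have h4 : u₁ * (u + v) ≤ u₁ * (u₀ + u₁) := by nlinarith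
        exact le_of_mul_le_mul_left h4 h1p
    calc (u + v) * P ≤ (u + v) * Q := mul_le_mul_of_nonneg_left hPQ (by linarith)
      _ ≤ (u₀ + u₁) * Q := mul_le_mul_of_nonneg_right hsum hQ.le

/-- **The 2×2 ratio lemma.** `A, B, C, D` (resp. `A', B', C', D'`) are the values of a
log-supermodular function at `S ∩ T, S, T, S ∪ T` (resp. at these sets with the extra element
`a`); the eight hypotheses are the log-supermodular inequalities of the 16-element lattice that
involve these values.  Then `B·C' + B'·C ≤ A·D' + A'·D`. -/
theorem ratio_cross_le (A B C D A' B' C' D' : R) (hA : 0 ≤ A) (hB : 0 ≤ B) (hC : 0 ≤ C)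
    (hD : 0 ≤ D) (hA' : 0 ≤ A') (_hB' : 0 ≤ B') (_hC' : 0 ≤ C') (hD' : 0 ≤ D')
    (hcc : B * C ≤ A * D) (hdd : B' * C' ≤ A' * D') (hcd : B * C' ≤ A * D')
    (hdc : B' * C ≤ A * D') (hr1 : A' * B ≤ A * B') (hr2 : A' * C ≤ A * C')
    (hr3 : B' * D ≤ B * D') (hr4 : C' * D ≤ C * D') :
    B * C' + B' * C ≤ A * D' + A' * D := by
  have hAD : 0 ≤ A' * D := mul_nonneg hA' hD
  have hAD' : 0 ≤ A * D' := mul_nonneg hA hD'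
  -- degenerate cases
  rcases eq_or_lt_of_le hB with hB0 | hBpos
  · rw [← hB0]; simp only [zero_mul, zero_add]; linarith
  rcases eq_or_lt_of_le hC with hC0 | hCpos
  · rw [← hC0]; simp only [mul_zero, add_zero]; linarith
  have hBC : 0 < B * C := mul_pos hBpos hCpos
  have hApos : 0 < A := by
    rcases eq_or_lt_of_le hA with hA0 | hA0
    · rw [← hA0] at hcc; simp at hcc; linarith
    · exact hA0
  have hDpos : 0 < D := by
    rcases eq_or_lt_of_le hD with hD0 | hD0
    · rw [← hD0] at hcc; simp at hcc; linarith
    · exact hD0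
  -- ratios
  set u₀ := A' / A with hu₀def
  set u := B' / B with hudef
  set v := C' / C with hvdef
  set u₁ := D' / D with hu₁def
  have eA' : A' = u₀ * A := by rw [hu₀def]; field_simp
  have eB' : B' = u * B := by rw [hudef]; field_simp
  have eC' : C' = v * C := by rw [hvdef]; field_simp
  have eD' : D' = u₁ * D := by rw [hu₁def]; field_simp
  have hu₀ : 0 ≤ u₀ := div_nonneg hA' hA
  have hAB : 0 < A * B := mul_pos hApos hBpos
  have hAC : 0 < A * C := mul_pos hApos hCpos
  have hBD : 0 < B * D := mul_pos hBpos hDpos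
  have hCD : 0 < C * D := mul_pos hCpos hDpos
  have h0u : u₀ ≤ u := by
    rw [eA', eB'] at hr1
    have : u₀ * (A * B) ≤ u * (A * B) := by linarith [hr1]
    exact le_of_mul_le_mul_right this hAB
  have h0v : u₀ ≤ v := by
    rw [eA', eC'] at hr2
    have : u₀ * (A * C) ≤ v * (A * C) := by linarith [hr2]
    exact le_of_mul_le_mul_right this hAC
  have hu1 : u ≤ u₁ := by
    rw [eB', eD'] at hr3
    have : u * (B * D) ≤ u₁ * (B * D) := by linarith [hr3]
    exact le_of_mul_le_mul_right this hBD
  have hv1 : v ≤ u₁ := by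
    rw [eC', eD'] at hr4
    have : v * (C * D) ≤ u₁ * (C * D) := by linarith [hr4]
    exact le_of_mul_le_mul_right this hCD
  have hv' : v * (B * C) ≤ u₁ * (A * D) := by rw [eC', eD'] at hcd; linarith [hcd]
  have hu' : u * (B * C) ≤ u₁ * (A * D) := by rw [eB', eD'] at hdc; linarith [hdc]
  have huv' : u * v * (B * C) ≤ u₀ * u₁ * (A * D) := by
    rw [eB', eC', eA', eD'] at hdd; linarith [hdd]
  have main := ratio_form u₀ u v u₁ (B * C) (A * D) hu₀ h0u h0v hu1 hv1 hBC hcc hv' hu' huv'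
  rw [eA', eB', eC', eD']
  linarith [main]

end RatioLemma

section Mixture

variable {V : Type*} [DecidableEq V] {R : Type*} [Field R] [LinearOrder R] [IsStrictOrderedRing R]

/-- The entry probability of the chain at the level `W`: `1` if `W` meets `ent`, `ρ` if `W`
meets only `ent'`, `0` otherwise. -/
def chainTheta (ent ent' : Finset V) (ρ : R) (W : Finset V) : R :=
  if ∃ r ∈ ent, r ∈ W then 1 else if ∃ r ∈ ent', r ∈ W then ρ else 0

/-- The κ-integrated value: `(1 − θ)·c + θ·d`. -/
def chainMix (ent ent' : Finset V) (ρ : R) (c d : Finset V → R) (W : Finset V) : R :=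
  (1 - chainTheta ent ent' ρ W) * c W + chainTheta ent ent' ρ W * d W

/-- If `ent` meets `s ∩ t` it meets `s`. -/
lemma meets_inter_left {ent s t : Finset V} (h : ∃ r ∈ ent, r ∈ s ∩ t) : ∃ r ∈ ent, r ∈ s := by
  obtain ⟨r, hr, hrs⟩ := h; exact ⟨r, hr, (Finset.mem_inter.1 hrs).1⟩

/-- If `ent` meets `s ∩ t` it meets `t`. -/
lemma meets_inter_right {ent s t : Finset V} (h : ∃ r ∈ ent, r ∈ s ∩ t) : ∃ r ∈ ent, r ∈ t := by
  obtain ⟨r, hr, hrs⟩ := h; exact ⟨r, hr, (Finset.mem_inter.1 hrs).2⟩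

/-- `ent` meets `s ∪ t` iff it meets `s` or `t`. -/
lemma meets_union_iff {ent s t : Finset V} :
    (∃ r ∈ ent, r ∈ s ∪ t) ↔ (∃ r ∈ ent, r ∈ s) ∨ (∃ r ∈ ent, r ∈ t) := by
  constructor
  · rintro ⟨r, hr, hrst⟩
    rcases Finset.mem_union.1 hrst with h | h
    · exact Or.inl ⟨r, hr, h⟩
    · exact Or.inr ⟨r, hr, h⟩
  · rintro (⟨r, hr, h⟩ | ⟨r, hr, h⟩)
    · exact ⟨r, hr, Finset.mem_union_left _ h⟩
    · exact ⟨r, hr, Finset.mem_union_right _ h⟩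

end Mixture

section Shapes

variable {R : Type*} [Field R] [LinearOrder R] [IsStrictOrderedRing R]

/-- Shape (I, 𝒟): `c_s · m_t ≤ c_∩ · m_∪`. -/
lemma shape_ID (ρ cs ct ci cu dt du : R) (hρ0 : 0 ≤ ρ) (hρ1 : ρ ≤ 1)
    (h_cc : cs * ct ≤ ci * cu) (h_cd : cs * dt ≤ ci * du) :
    cs * ((1 - ρ) * ct + ρ * dt) ≤ ci * ((1 - ρ) * cu + ρ * du) := by
  have h1 := mul_le_mul_of_nonneg_left h_cc (by linarith : (0 : R) ≤ 1 - ρ)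
  have h2 := mul_le_mul_of_nonneg_left h_cd hρ0
  nlinarith

/-- Shape (𝒟, I). -/
lemma shape_DI (ρ cs ct ci cu ds du : R) (hρ0 : 0 ≤ ρ) (hρ1 : ρ ≤ 1)
    (h_cc : cs * ct ≤ ci * cu) (h_dc : ds * ct ≤ ci * du) :
    ((1 - ρ) * cs + ρ * ds) * ct ≤ ci * ((1 - ρ) * cu + ρ * du) := by
  have h1 := mul_le_mul_of_nonneg_left h_cc (by linarith : (0 : R) ≤ 1 - ρ)
  have h2 := mul_le_mul_of_nonneg_left h_dc hρ0
  nlinarith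

/-- Shape (𝒟, 𝒟) with the meet in `I`. -/
lemma shape_DD_I (ρ cs ct ci cu ds dt di du : R) (hρ0 : 0 ≤ ρ) (hρ1 : ρ ≤ 1) (hci : 0 ≤ ci)
    (hdu : 0 ≤ du)
    (h_cc : cs * ct ≤ ci * cu) (h_dd : ds * dt ≤ di * du) (h_cd : cs * dt ≤ ci * du)
    (h_dc : ds * ct ≤ ci * du) (hdc_i : di ≤ ci) (hdc_u : du ≤ cu) :
    ((1 - ρ) * cs + ρ * ds) * ((1 - ρ) * ct + ρ * dt) ≤ ci * ((1 - ρ) * cu + ρ * du) := by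
  have hρ' : (0 : R) ≤ 1 - ρ := by linarith
  have h1 := mul_le_mul_of_nonneg_left h_cc (mul_nonneg hρ' hρ')
  have h2 := mul_le_mul_of_nonneg_left h_cd (mul_nonneg hρ0 hρ')
  have h3 := mul_le_mul_of_nonneg_left h_dc (mul_nonneg hρ0 hρ')
  have h4 := mul_le_mul_of_nonneg_left h_dd (mul_nonneg hρ0 hρ0)
  have h5 : ρ * ρ * (di * du) ≤ ρ * ρ * (ci * du) :=
    mul_le_mul_of_nonneg_left (mul_le_mul_of_nonneg_right hdc_i hdu) (mul_nonneg hρ0 hρ0)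
  have h6 : 0 ≤ ρ * (1 - ρ) * (ci * (cu - du)) :=
    mul_nonneg (mul_nonneg hρ0 hρ') (mul_nonneg hci (by linarith))
  nlinarith

/-- Shape (𝒟, 𝒟) with the meet in `𝒟`. -/
lemma shape_DD_D (ρ cs ct ci cu ds dt di du : R) (hρ0 : 0 ≤ ρ) (hρ1 : ρ ≤ 1)
    (h_cc : cs * ct ≤ ci * cu) (h_dd : ds * dt ≤ di * du)
    (h_cross : cs * dt + ds * ct ≤ ci * du + di * cu) :
    ((1 - ρ) * cs + ρ * ds) * ((1 - ρ) * ct + ρ * dt) ≤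
      ((1 - ρ) * ci + ρ * di) * ((1 - ρ) * cu + ρ * du) := by
  have hρ' : (0 : R) ≤ 1 - ρ := by linarith
  have h1 := mul_le_mul_of_nonneg_left h_cc (mul_nonneg hρ' hρ')
  have h2 := mul_le_mul_of_nonneg_left h_cross (mul_nonneg hρ0 hρ')
  have h4 := mul_le_mul_of_nonneg_left h_dd (mul_nonneg hρ0 hρ0)
  nlinarith

/-- Shape (𝒟, 𝒰⁰) with the meet in `I`. -/
lemma shape_DU_I (ρ cs ci ds dt di du : R) (hρ0 : 0 ≤ ρ) (hρ1 : ρ ≤ 1) (hdu : 0 ≤ du)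
    (h_cd : cs * dt ≤ ci * du) (h_dd : ds * dt ≤ di * du) (hdc_i : di ≤ ci) :
    ((1 - ρ) * cs + ρ * ds) * dt ≤ ci * du := by
  have hρ' : (0 : R) ≤ 1 - ρ := by linarith
  have h1 := mul_le_mul_of_nonneg_left h_cd hρ'
  have h2 := mul_le_mul_of_nonneg_left h_dd hρ0
  have h3 : ρ * (di * du) ≤ ρ * (ci * du) :=
    mul_le_mul_of_nonneg_left (mul_le_mul_of_nonneg_right hdc_i hdu) hρ0
  nlinarith

/-- Shape (𝒰⁰, 𝒟) with the meet in `I`. -/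
lemma shape_UD_I (ρ ct ci ds dt di du : R) (hρ0 : 0 ≤ ρ) (hρ1 : ρ ≤ 1) (hdu : 0 ≤ du)
    (h_dc : ds * ct ≤ ci * du) (h_dd : ds * dt ≤ di * du) (hdc_i : di ≤ ci) :
    ds * ((1 - ρ) * ct + ρ * dt) ≤ ci * du := by
  have hρ' : (0 : R) ≤ 1 - ρ := by linarith
  have h1 := mul_le_mul_of_nonneg_left h_dc hρ'
  have h2 := mul_le_mul_of_nonneg_left h_dd hρ0
  have h3 : ρ * (di * du) ≤ ρ * (ci * du) :=
    mul_le_mul_of_nonneg_left (mul_le_mul_of_nonneg_right hdc_i hdu) hρ0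
  nlinarith

/-- Shape (𝒟, 𝒰⁰) with the meet in `𝒟`. -/
lemma shape_DU_D (ρ cs ci ds dt di du : R) (hρ0 : 0 ≤ ρ) (hρ1 : ρ ≤ 1)
    (h_cd : cs * dt ≤ ci * du) (h_dd : ds * dt ≤ di * du) :
    ((1 - ρ) * cs + ρ * ds) * dt ≤ ((1 - ρ) * ci + ρ * di) * du := by
  have hρ' : (0 : R) ≤ 1 - ρ := by linarith
  have h1 := mul_le_mul_of_nonneg_left h_cd hρ'
  have h2 := mul_le_mul_of_nonneg_left h_dd hρ0
  nlinarith

/-- Shape (𝒰⁰, 𝒟) with the meet in `𝒟`. -/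
lemma shape_UD_D (ρ ct ci ds dt di du : R) (hρ0 : 0 ≤ ρ) (hρ1 : ρ ≤ 1)
    (h_dc : ds * ct ≤ ci * du) (h_dd : ds * dt ≤ di * du) :
    ds * ((1 - ρ) * ct + ρ * dt) ≤ ((1 - ρ) * ci + ρ * di) * du := by
  have hρ' : (0 : R) ≤ 1 - ρ := by linarith
  have h1 := mul_le_mul_of_nonneg_left h_dc hρ'
  have h2 := mul_le_mul_of_nonneg_left h_dd hρ0
  nlinarith

/-- Shape (𝒰⁰, 𝒰⁰) with the meet in `I`. -/
lemma shape_UU_I (ci ds dt di du : R) (hdu : 0 ≤ du) (h_dd : ds * dt ≤ di * du) (hdc_i : di ≤ ci) :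
    ds * dt ≤ ci * du :=
  le_trans h_dd (mul_le_mul_of_nonneg_right hdc_i hdu)

/-- Shape (𝒰⁰, 𝒰⁰) with the meet in `𝒟`. -/
lemma shape_UU_D (ρ ci ds dt di du : R) (hρ1 : ρ ≤ 1) (hdu : 0 ≤ du)
    (h_dd : ds * dt ≤ di * du) (hdc_i : di ≤ ci) :
    ds * dt ≤ ((1 - ρ) * ci + ρ * di) * du := by
  have hρ' : (0 : R) ≤ 1 - ρ := by linarith
  have h3 : (1 - ρ) * (di * du) ≤ (1 - ρ) * (ci * du) :=
    mul_le_mul_of_nonneg_left (mul_le_mul_of_nonneg_right hdc_i hdu) hρ'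
  nlinarith

end Shapes

section MixtureMain

variable {V : Type*} [DecidableEq V] {R : Type*} [Field R] [LinearOrder R] [IsStrictOrderedRing R]

/-- **The three-region mixture is log-supermodular.** Hypotheses: `c, d ≥ 0`, `d ≤ c`, `c` and `d`
log-supermodular, jointly log-supermodular (`c s · d t ≤ c (s ∩ t) · d (s ∪ t)`), and the ratio
`d / c` increasing (`d s · c t ≤ c s · d t` for `s ⊆ t`); `0 ≤ ρ ≤ 1`. -/
theorem mixture_lsm (ent ent' : Finset V) (ρ : R) (hρ0 : 0 ≤ ρ) (hρ1 : ρ ≤ 1)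
    (c d : Finset V → R) (hc0 : ∀ W, 0 ≤ c W) (hd0 : ∀ W, 0 ≤ d W) (hdc : ∀ W, d W ≤ c W)
    (hcc : ∀ s t, c s * c t ≤ c (s ∩ t) * c (s ∪ t))
    (hdd : ∀ s t, d s * d t ≤ d (s ∩ t) * d (s ∪ t))
    (hcd : ∀ s t, c s * d t ≤ c (s ∩ t) * d (s ∪ t))
    (hratio : ∀ s t, s ⊆ t → d s * c t ≤ c s * d t) (s t : Finset V) :
    chainMix ent ent' ρ c d s * chainMix ent ent' ρ c d t ≤
      chainMix ent ent' ρ c d (s ∩ t) * chainMix ent ent' ρ c d (s ∪ t) := by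
  have h_cc := hcc s t
  have h_dd := hdd s t
  have h_cd := hcd s t
  have h_dc : d s * c t ≤ c (s ∩ t) * d (s ∪ t) := by
    have := hcd t s; rw [Finset.inter_comm, Finset.union_comm] at this; linarith
  have h_r1 := hratio (s ∩ t) s Finset.inter_subset_left
  have h_r2 := hratio (s ∩ t) t Finset.inter_subset_right
  have h_r3 := hratio s (s ∪ t) Finset.subset_union_left
  have h_r4 := hratio t (s ∪ t) Finset.subset_union_right
  have h_cross : c s * d t + d s * c t ≤ c (s ∩ t) * d (s ∪ t) + d (s ∩ t) * c (s ∪ t) :=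
    ratio_cross_le (c (s ∩ t)) (c s) (c t) (c (s ∪ t)) (d (s ∩ t)) (d s) (d t) (d (s ∪ t))
      (hc0 _) (hc0 _) (hc0 _) (hc0 _) (hd0 _) (hd0 _) (hd0 _) (hd0 _) h_cc h_dd h_cd h_dc
      h_r1 h_r2 h_r3 h_r4
  have hdc_i := hdc (s ∩ t)
  have hdc_u := hdc (s ∪ t)
  have hc_i := hc0 (s ∩ t)
  have hd_u := hd0 (s ∪ t)
  have hu0 : (∃ r ∈ ent, r ∈ s ∪ t) ↔ (∃ r ∈ ent, r ∈ s) ∨ (∃ r ∈ ent, r ∈ t) := meets_union_iff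
  have hu1 : (∃ r ∈ ent', r ∈ s ∪ t) ↔ (∃ r ∈ ent', r ∈ s) ∨ (∃ r ∈ ent', r ∈ t) :=
    meets_union_iff
  unfold chainMix chainTheta
  by_cases hs0 : ∃ r ∈ ent, r ∈ s <;> by_cases ht0 : ∃ r ∈ ent, r ∈ t <;>
    by_cases hs1 : ∃ r ∈ ent', r ∈ s <;> by_cases ht1 : ∃ r ∈ ent', r ∈ t <;>
    by_cases hi0 : ∃ r ∈ ent, r ∈ s ∩ t <;> by_cases hi1 : ∃ r ∈ ent', r ∈ s ∩ t
  all_goals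
    first
    | exact absurd (meets_inter_left hi0) hs0
    | exact absurd (meets_inter_right hi0) ht0
    | exact absurd (meets_inter_left hi1) hs1
    | exact absurd (meets_inter_right hi1) ht1
    | skip
  all_goals
    simp only [hs0, ht0, hs1, ht1, hi0, hi1, hu0, hu1, or_true, true_or, or_self, if_true,
      if_false, sub_self, zero_mul, sub_zero, one_mul, zero_add, add_zero]
  all_goals
    first
    | exact h_cc
    | exact h_cd
    | exact h_dc
    | exact h_dd
    | exact shape_ID ρ _ _ _ _ _ _ hρ0 hρ1 h_cc h_cd
    | exact shape_DI ρ _ _ _ _ _ _ hρ0 hρ1 h_cc h_dc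
    | exact shape_DD_I ρ _ _ _ _ _ _ _ _ hρ0 hρ1 hc_i hd_u h_cc h_dd h_cd h_dc hdc_i hdc_u
    | exact shape_DD_D ρ _ _ _ _ _ _ _ _ hρ0 hρ1 h_cc h_dd h_cross
    | exact shape_DU_I ρ _ _ _ _ _ _ hρ0 hρ1 hd_u h_cd h_dd hdc_i
    | exact shape_UD_I ρ _ _ _ _ _ _ hρ0 hρ1 hd_u h_dc h_dd hdc_i
    | exact shape_DU_D ρ _ _ _ _ _ _ hρ0 hρ1 h_cd h_dd
    | exact shape_UD_D ρ _ _ _ _ _ _ hρ0 hρ1 h_dc h_dd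
    | exact shape_UU_I _ _ _ _ _ hd_u h_dd hdc_i
    | exact shape_UU_D ρ _ _ _ _ _ hρ1 hd_u h_dd hdc_i

end MixtureMain


end Summit.Ventures.PercRepro2.Coin
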